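import Summits.BirchSwinnertonDyer.Rank1Residual.X11a.MainConjecture
import Summits.BirchSwinnertonDyer.Rank1Residual.X1.MuLambdaAlgebra
import HarnessLib

/-!
# Class X11a: Mazur's main conjecture at a multiplicative prime from the IWASAWA INVARIANTS
# `μ^alg = μ^an`, `λ^alg = λ^an` at the pair (the endpoint of the Emerton–Pollack–Weston route)
# (cell `b2b-bsdres`, unit `b2b-bsdres-x11a`, gen 13)

HONEST FRAMING (run/shared/lean/b2b/bsd-rank1-residual/, verbatim in every file): the goal of the
cell is to DELETE the COMBINATION-SHAPED residual classes of the Birch–Swinnerton-Dyer formula for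
ALL analytic-rank `≤ 1` elliptic curves over `ℚ` — "full BSD formula for every rank `≤ 1` curve in
class `C`" assembled STRICTLY from published theorems — so that the rank-`≤ 1` remainder becomes
exactly the CONSTRUCTION-SHAPED classes, which are TYPED (missing-input `Prop`s), NOT attempted.
This is not "finishing BSD". Research route; NO CLAIM BEYOND STATED CLASSES. One definition (a
typed input, shape only) and theorems; no named fact.

**Context** (`HOME/b2b-bsdres-x11a/X11A-CHAIN.md`, a CANDIDATE chain under audit): Emerton–Pollack–
Weston, Invent. Math. 163 (2006), Thm. 5.1.3 transports, along the Hida family `H(ρ̄)` of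
`ρ̄ = E[p]`, the statement "`μ^alg = μ^an = 0` and `λ^alg = λ^an`" from ANY member where it is known
(e.g. a good-ordinary member of higher weight, where the RATIONAL main conjecture is X. Wan, Forum
Math. Sigma 3 (2015) Thm. 4, without (ram)) to the `p`-new weight-two member `f_E` (`p ‖ N`). This
file is the KERNEL ENDPOINT of that route at the pair `(E, p)`, independent of how the invariants
are obtained: it types EPW's conclusion at `f_E` in the tree's vocabulary and proves that, together
with Kato's divisibility for surjective image (tree fact
`Wuthrich2014.kato_charIdeal_dvd_multiplicative_of_surjective`, PUB, flag `Wu14-surj-attribution`),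
it is EQUIVALENT to Mazur's main conjecture at the pair (`X2.MazurMainConjectureAt W p`, the typed
missing input of X11a's leaf, `X11a/Cells.lean`), in analytic rank `0`.

* `InvariantsMatchAt W p` — for every datum `(κ, γ, f, ϖ, D)`, every generator `f_E` of
  `char_Λ X(E/ℚ_∞)` and every `g ∈ Λ` with `ι(T^e · g) = ϖ · L_p` (`e = 1` split, `0` non-split;
  `L_p` THE Mazur–Tate–Teitelbaum function of `X2.MazurMainConjectureAt`): `μ(g) = μ(f_E)` and
  `λ(g) = λ(f_E)`, with `μ`, `λ` the tree's `X1.MuLambda.mu/lam` on `Λ = ℤ_p⟦T⟧` (eisenstein-p1,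
  `X1/MuLambdaAlgebra.lean`). This is EPW's "`μ^alg(f_E) = μ^an(f_E)` and `λ^alg(f_E) = λ^an(f_E)`"
  (EPW §5.1: `L^alg` = characteristic power series of the dual of GREENBERG's Selmer group = `T^e·f_E`,
  `L^an` = the canonical-period `p`-adic `L`-function = `ϖ·L_p` up to `ℤ_p^×` at `p ‖ N` under (irr);
  the common factor `T^e` and units change neither difference — bridges of x11a gen 8,
  `EmertonPollackWeston2006/HidaFamilyTransfer.lean`). A `Prop`; nothing asserted.
* `mazurMainConjectureAt_of_invariantsMatchAt` — at a multiplicative `p ≥ 5` with `ρ̄` surjective and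
  `r_an = 0`: Kato (`hKato`) gives `g = h · f_E`; equal `μ` and `λ` force `h ∈ Λ^×`
  (`X1.MuLambda.span_eq_span_iff_mu_lam`): the main conjecture at every datum. (Rank `0` is used
  only for `L_p ≠ 0`: `L_p(0) = 2[0]⁺_f ≠ 0` non-split, `[T¹]L_p ≠ 0` split by Greenberg–Stevens and
  `𝓛_p ≠ 0`.)
* `invariantsMatchAt_of_mazurMainConjectureAt` — conversely (pure algebra: `ι` injective, `Λ` a
  domain, generators differ by units), so `invariantsMatchAt_iff_mazurMainConjectureAt`: on X11a's
  surjective leaf the EPW-shaped input is EXACT as well (⟺ MC ⟺ `BSD(E,p)`, `X11a/MainConjectureCertificates.lean`).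

What this does NOT do: it does not supply the invariants (that is the chain's published part —
Wan 2015 Thm. 4 at a higher-weight member, EPW Thms. 1 and 5.1.3, a per-pair certificate
`μ^an(E,p) = 0` — NOT typed here, under audit); no label change.

References: [EmertonPollackWeston2006] Thm. 1, Thm. 5.1.2 (Kato), Thm. 5.1.3, Cor. 5.1.4, Ex. 5.3.1;
[GreenbergVatsal2000] p. 4 ("`λ_alg = λ_an` … `μ_alg = μ_an` then implies the Main [statement]");
[Wuthrich2014] Thm. 3, Cor. 19; [Skinner2016PacificMC] §3.2–3.3 (Greenberg vs classical Selmer,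
canonical vs Néron period); [GreenbergStevens1993]; [MazurTateTeitelbaum1986] §I.14–15.
-/

set_option autoImplicit false

noncomputable section

open scoped Classical MatrixGroups ModularForm

open CongruenceSubgroup WeierstrassCurve Literature.NumberTheory.EllipticCurves
  Literature.NumberTheory.EllipticCurves.ModularForms
  Literature.NumberTheory.EllipticCurves.Rank1Residual
  Literature.NumberTheory.EllipticCurves.Rank1Residual.Typed
  Literature.NumberTheory.EllipticCurves.Wuthrich2014
  Summit.BirchSwinnertonDyer.Rank1Residual.X1.MuLambda

namespace Summit.BirchSwinnertonDyer.Rank1Residual.X11a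

/-! ### The typed input: EPW's invariants statement at the pair -/

/-- **Emerton–Pollack–Weston's conclusion at `(E, p)`, `p ‖ N`, in the tree's vocabulary**
("`μ^alg(f_E) = μ^an(f_E)` and `λ^alg(f_E) = λ^an(f_E)`", Invent. Math. 163 (2006) Thm. 5.1.3,
conclusion shape only; nothing asserted): for the cyclotomic data `(κ, γ)`, every newform `f` of
`W`, every `ϖ` with `ϖ·Ω_E = Ω⁺_f`, every dual datum `D`, every generator `fE` of `char_Λ X` and
every `g ∈ Λ` with `ι(g) = ϖ·L` for THE non-split Mazur–Tate–Teitelbaum function (non-split `p`),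
resp. `ι(T·g) = ϖ·L` for THE split one (split `p`): `μ(g) = μ(fE)` and `λ(g) = λ(fE)`
(`X1.MuLambda.mu/lam`). [cite: EmertonPollackWeston2006, Thm. 5.1.3 and §5.1 (shape only; nothing asserted)]
[cite: GreenbergVatsal2000, p. 4 (after Thm. (1.2)) (shape only; nothing asserted)] -/
def InvariantsMatchAt (W : WeierstrassCurve ℚ) [W.IsElliptic] [W.IsGloballyMinimal] (p : ℕ)
    [Fact p.Prime] : Prop :=
  ∀ (κ : ZpExtension ℚ p) (γ : Field.absoluteGaloisGroup ℚ),
      κ.IsCyclotomic → κ.IsTopGenerator γ → IsCyclotomicVariable p γ →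
    ∀ {N : ℕ} [NeZero N] (f : CuspForm (Gamma0 N) 2), IsNewformOf W f →
    ∀ (D : W.SelmerDualData κ γ) (ϖ : ℚ), (ϖ : ℝ) * W.realPeriodRat = plusPeriod f →
    ∀ (fE g : IwasawaAlgebra p), D.charIdeal = Ideal.span {fE} →
      (¬ W.HasSplitMultiplicativeReductionAtPrime p →
        ∀ L : PowerSeries ℚ_[p], IsMultPAdicLFunctionOf f p (-1) L →
          iwasawaToPowerSeries p g = PowerSeries.C ((ϖ : ℚ) : ℚ_[p]) * L →
            mu g = mu fE ∧ lam g = lam fE) ∧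
      (W.HasSplitMultiplicativeReductionAtPrime p →
        ∀ L : PowerSeries ℚ_[p], IsSplitMultPAdicLFunctionOf f p L →
          iwasawaToPowerSeries p (PowerSeries.X * g) = PowerSeries.C ((ϖ : ℚ) : ℚ_[p]) * L →
            mu g = mu fE ∧ lam g = lam fE)

/-! ### Invariants + Kato ⟹ Mazur's main conjecture at the pair -/

/-- **At a multiplicative `p ≥ 5` with surjective `ρ̄_{E,p}` and `ord_{s=1}L(E,s) = 0`:
`InvariantsMatchAt W p` ⟹ Mazur's main conjecture at `(E,p)`.** Kato's divisibility for surjective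
image (`hKato`; every `ρ̄_{p^n}` onto by Serre) gives `g = h · f_E ∈ char_Λ X = (f_E)` with
`ι(T^e g) = ϖ L_p`; the hypothesis gives `μ(g) = μ(f_E)`, `λ(g) = λ(f_E)`, hence `(g) = (f_E)` and
`h ∈ Λ^×` (`X1.MuLambda.span_eq_span_iff_mu_lam`, `span_eq_span_iff_isUnit`: `Λ` is a domain and
`Λ^× = {μ = λ = 0}`); `g ≠ 0` because `L_p(0) = 2[0]⁺_f ≠ 0` (non-split, MTT) resp.
`[T¹]L_p · log κ(γ) = 𝓛_p[0]⁺_f ≠ 0` (split: Greenberg–Stevens `hGS`, `𝓛_p ≠ 0`), `[0]⁺_f ≠ 0` by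
`r_an = 0` (modularity `hmod`). [cite: EmertonPollackWeston2006, Thm. 5.1.2 and Thm. 5.1.3]
[cite: GreenbergVatsal2000, p. 4 (after Thm. (1.2))] [cite: Wuthrich2014, Thm. 3 (p. 382) and Cor. 19 proof (p. 399)] -/
theorem mazurMainConjectureAt_of_invariantsMatchAt
    (hKato : kato_charIdeal_dvd_multiplicative_of_surjective) (hmod : hasEntireLFunction_rat)
    (W : WeierstrassCurve ℚ) [W.IsElliptic] [W.IsGloballyMinimal] (p : ℕ) [Fact p.Prime]
    (hGS : greenberg_stevens (W := W) (p := p))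
    (hp : 5 ≤ p) (hmult : W.HasMultiplicativeReductionAtPrime p)
    (hsurj : W.HasSurjectiveModNGaloisRep p) (hr : W.analyticRank = 0)
    (hinv : InvariantsMatchAt W p) : X2.MazurMainConjectureAt W p := by
  intro κ γ hκ hγ hγ' N _ f hf D ϖ hϖ
  have hp2 : p ≠ 2 := by omega
  haveI : Module.Finite (IwasawaAlgebra p) D.X := D.module_finite_holds hγ
  have hsurj' : ∀ n : ℕ, W.HasSurjectiveModNGaloisRep (p ^ n : ℕ) :=
    kato_charIdeal_dvd_multiplicative_of_surjective.surjective_pow_of_five_le W p hp hsurj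
  obtain ⟨hX, hKns, hKs⟩ := hKato W p hp2 hmult hsurj' hκ hγ hγ' hf D ϖ hϖ
  haveI : (Literature.NumberTheory.EllipticCurves.Module.charIdeal (IwasawaAlgebra p) D.X).IsPrincipal :=
    charIdeal_isPrincipal_holds p D.X
  obtain ⟨fE, hfE⟩ := Submodule.IsPrincipal.principal
    (Literature.NumberTheory.EllipticCurves.Module.charIdeal (IwasawaAlgebra p) D.X)
  have hchar : D.charIdeal = Ideal.span {fE} := hfE
  -- rank `0`: `[0]⁺_f ≠ 0`, `ϖ ≠ 0`
  have hL1 : W.entireLFunction 1 ≠ 0 := (W.analyticRank_eq_zero_iff_holds (hmod W)).1 hr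
  have hϖ0 : ϖ ≠ 0 := by
    rintro rfl
    have hper : 0 < plusPeriod f := IsNewform0.plusPeriod_pos_holds hf.1 hf.coeffField_eq_bot
    rw [← hϖ, Rat.cast_zero, zero_mul] at hper
    exact lt_irrefl _ hper
  set s : ℚ := ratPlusSymbol f 0 with hs_def
  have hLval : W.entireLFunction 1 = (((s : ℝ) * plusPeriod f : ℝ) : ℂ) := hf.entireLFunction_one_eq
  have hs0 : s ≠ 0 := by
    intro h0
    apply hL1
    rw [hLval, h0]
    simp
  have hsQ0 : (s : ℚ_[p]) ≠ 0 := by exact_mod_cast hs0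
  have hϖQ0 : ((ϖ : ℚ) : ℚ_[p]) ≠ 0 := by exact_mod_cast hϖ0
  -- from `(g) = (fE)` with `g = h·fE` to the unit `w`
  have unit_of : ∀ (g h : IwasawaAlgebra p), h * fE = g → g ≠ 0 → mu g = mu fE ∧ lam g = lam fE →
      IsUnit h := by
    intro g h hgh hg0 hml
    have hfE0 : fE ≠ 0 := by
      rintro rfl
      exact hg0 (by rw [← hgh, mul_zero])
    have hfac : g = fE * h := by rw [← hgh, mul_comm]
    have hspan : Ideal.span ({g} : Set (IwasawaAlgebra p)) = Ideal.span {fE} :=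
      (span_eq_span_iff_mu_lam hfE0 hg0 hfac).mpr hml
    exact (span_eq_span_iff_isUnit hfE0 hfac).mp hspan
  refine ⟨hX, fE, hchar, fun hsplit L hL => ?_, fun hns L hL => ?_⟩
  · -- split: `ι(T·g) = ϖ·L`, `[T¹]`: `g(0) = ϖ·[T¹]L ≠ 0`
    obtain ⟨g, hgmem, hιg⟩ := hKs hsplit L hL
    have hgmem' : g ∈ Ideal.span {fE} := by rw [← hchar]; exact hgmem
    obtain ⟨h, hgh⟩ := Ideal.mem_span_singleton'.mp hgmem'
    obtain ⟨Dq⟩ := (nonempty_tateParameterData_iff_holds (W := W) (p := p)).mpr hsplit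
    obtain ⟨-, hGS1⟩ := hGS Dq hf hL
    have h𝓛0 : LInvariant Dq ≠ 0 := LInvariant_ne_zero_holds Dq
    have hc1 : PowerSeries.coeff 1 L ≠ 0 := by
      intro h0
      rw [h0, zero_mul] at hGS1
      exact (mul_ne_zero h𝓛0 hsQ0) hGS1.symm
    have h1 : ((PowerSeries.constantCoeff g : ℤ_[p]) : ℚ_[p]) =
        ((ϖ : ℚ) : ℚ_[p]) * PowerSeries.coeff 1 L := by
      have h := congrArg (PowerSeries.coeff 1) hιg
      rw [iwasawaToPowerSeries, PowerSeries.coeff_map, PowerSeries.coeff_succ_X_mul,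
        PowerSeries.coeff_zero_eq_constantCoeff, PowerSeries.coeff_C_mul] at h
      exact h
    have hg0 : g ≠ 0 := by
      intro h0
      have : ((PowerSeries.constantCoeff g : ℤ_[p]) : ℚ_[p]) = 0 := by
        rw [h0, map_zero, PadicInt.coe_zero]
      rw [h1] at this
      exact (mul_ne_zero hϖQ0 hc1) this
    have hml := (hinv κ γ hκ hγ hγ' f hf D ϖ hϖ fE g hchar).2 hsplit L hL hιg
    have hunit : IsUnit h := unit_of g h hgh hg0 hml
    refine ⟨hunit.unit, ?_⟩
    rw [IsUnit.unit_spec, show (PowerSeries.X : IwasawaAlgebra p) * fE * h = PowerSeries.X * g by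
      rw [← hgh]; ring]
    exact hιg
  · -- non-split: `ι(g) = ϖ·L`, `g(0) = ϖ·2[0]⁺_f ≠ 0`
    obtain ⟨g, hgmem, hιg⟩ := hKns hns L hL
    have hgmem' : g ∈ Ideal.span {fE} := by rw [← hchar]; exact hgmem
    obtain ⟨h, hgh⟩ := Ideal.mem_span_singleton'.mp hgmem'
    have hL0 : PowerSeries.constantCoeff L = 2 * (s : ℚ_[p]) := hL.constantCoeff_of_neg_one
    have h1 : ((PowerSeries.constantCoeff g : ℤ_[p]) : ℚ_[p]) =
        ((ϖ : ℚ) : ℚ_[p]) * (2 * (s : ℚ_[p])) := by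
      have h := congrArg PowerSeries.constantCoeff hιg
      rw [constantCoeff_iwasawaToPowerSeries, map_mul, PowerSeries.constantCoeff_C, hL0] at h
      exact h
    have hg0 : g ≠ 0 := by
      intro h0
      have : ((PowerSeries.constantCoeff g : ℤ_[p]) : ℚ_[p]) = 0 := by
        rw [h0, map_zero, PadicInt.coe_zero]
      rw [h1] at this
      exact (mul_ne_zero hϖQ0 (mul_ne_zero two_ne_zero hsQ0)) this
    have hml := (hinv κ γ hκ hγ hγ' f hf D ϖ hϖ fE g hchar).1 hns L hL hιg
    have hunit : IsUnit h := unit_of g h hgh hg0 hml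
    refine ⟨hunit.unit, ?_⟩
    rw [IsUnit.unit_spec, show fE * h = g by rw [← hgh]; ring]
    exact hιg

/-! ### The converse (pure algebra) and the equivalence -/

/-- Units of `Λ` have `μ = λ = 0`, so `μ`, `λ` are insensitive to unit factors. [folklore] -/
theorem mu_lam_mul_unit {p : ℕ} [Fact p.Prime] {a : IwasawaAlgebra p} (ha : a ≠ 0)
    (u : (IwasawaAlgebra p)ˣ) : mu (a * (u : IwasawaAlgebra p)) = mu a ∧ lam (a * (u : IwasawaAlgebra p)) = lam a := by
  obtain ⟨hu0, hmu, hlam⟩ := (isUnit_iff_mu_eq_zero_and_lam_eq_zero (u : IwasawaAlgebra p)).mp u.isUnit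
  rw [mu_mul ha hu0, lam_mul ha hu0, hmu, hlam]
  exact ⟨add_zero _, add_zero _⟩

/-- **Mazur's main conjecture at `(E,p)` ⟹ `InvariantsMatchAt W p`** (no hypothesis on the pair
beyond `p ‖ N` being multiplicative for the statement to be the intended one): the conjecture gives
`ι(T^e · f_E' · w) = ϖ · L_p` for a generator `f_E'` and a unit `w`; `ι` is injective and `Λ` a
domain, so any `g` with `ι(T^e g) = ϖ L_p` is `f_E' · w`, and any generator `f_E` is `f_E' · u`;
units have `μ = λ = 0`. [cite: GreenbergVatsal2000, p. 4 (after Thm. (1.2))]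
[cite: EmertonPollackWeston2006, §5.1 (statement 5.1.1 vs Thm. 5.1.3)] -/
theorem invariantsMatchAt_of_mazurMainConjectureAt
    (W : WeierstrassCurve ℚ) [W.IsElliptic] [W.IsGloballyMinimal] (p : ℕ) [Fact p.Prime]
    (hMC : X2.MazurMainConjectureAt W p) : InvariantsMatchAt W p := by
  intro κ γ hκ hγ hγ' N _ f hf D ϖ hϖ fE g hchar
  obtain ⟨-, fE', hchar', hsp, hnsp⟩ := hMC κ γ hκ hγ hγ' f hf D ϖ hϖ
  have hinj := iwasawaToPowerSeries_injective p
  -- `fE' = fE * u` for a unit `u`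
  obtain ⟨u, hu⟩ := Ideal.span_singleton_eq_span_singleton.mp (hchar.symm.trans hchar')
  -- shared ending: from `g = fE' * w` conclude
  have finish : ∀ w : (IwasawaAlgebra p)ˣ, g = fE' * (w : IwasawaAlgebra p) →
      mu g = mu fE ∧ lam g = lam fE := by
    intro w hgw
    by_cases h0 : fE = 0
    · have hf' : fE' = 0 := by rw [← hu, h0, zero_mul]
      have hg : g = 0 := by rw [hgw, hf', zero_mul]
      rw [hg, h0]
      exact ⟨rfl, rfl⟩
    · have hg' : g = fE * ((u * w : (IwasawaAlgebra p)ˣ) : IwasawaAlgebra p) := by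
        rw [hgw, ← hu, Units.val_mul, mul_assoc]
      rw [hg']
      exact mu_lam_mul_unit h0 (u * w)
  refine ⟨fun hns L hL hιg => ?_, fun hsplit L hL hιg => ?_⟩
  · obtain ⟨w, hw⟩ := hnsp hns L hL
    exact finish w (hinj (hιg.trans hw.symm))
  · obtain ⟨w, hw⟩ := hsp hsplit L hL
    have hXg : (PowerSeries.X : IwasawaAlgebra p) * g =
        PowerSeries.X * (fE' * (w : IwasawaAlgebra p)) := by
      have := hinj (hιg.trans hw.symm)
      rw [this]; ring
    exact finish w (mul_left_cancel₀ PowerSeries.X_ne_zero hXg)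

/-- **At a multiplicative `p ≥ 5` with surjective `ρ̄_{E,p}` and `ord_{s=1}L(E,s) = 0`:
`InvariantsMatchAt W p ⟺ X2.MazurMainConjectureAt W p`** — the EPW-shaped input is EXACT at the
pair (and ⟺ `BSD(E,p)` by `X11a.mazurMainConjectureAt_iff_bsdp`).
[cite: EmertonPollackWeston2006, Thm. 5.1.2 and Thm. 5.1.3] [cite: GreenbergVatsal2000, p. 4 (after Thm. (1.2))] -/
theorem invariantsMatchAt_iff_mazurMainConjectureAt
    (hKato : kato_charIdeal_dvd_multiplicative_of_surjective) (hmod : hasEntireLFunction_rat)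
    (W : WeierstrassCurve ℚ) [W.IsElliptic] [W.IsGloballyMinimal] (p : ℕ) [Fact p.Prime]
    (hGS : greenberg_stevens (W := W) (p := p))
    (hp : 5 ≤ p) (hmult : W.HasMultiplicativeReductionAtPrime p)
    (hsurj : W.HasSurjectiveModNGaloisRep p) (hr : W.analyticRank = 0) :
    InvariantsMatchAt W p ↔ X2.MazurMainConjectureAt W p :=
  ⟨mazurMainConjectureAt_of_invariantsMatchAt hKato hmod W p hGS hp hmult hsurj hr,
    invariantsMatchAt_of_mazurMainConjectureAt W p⟩

/-- **Hence `BSD(E,p)` from the invariants** (X11a's surjective leaf and row C1 alike): the EPW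
endpoint composed with the gen-8 / eisenstein-p2 glue `X2.bsdp_of_mazurMainConjectureAt_of_analyticRank_eq_zero`
(Stein–Wuthrich Thm. 6.1 `hJs`/`hJn`, heights `hHs`/`hHn`, Greenberg–Stevens, GZK `hGZK`, modularity
`hmod`/`hpar`). [cite: EmertonPollackWeston2006, Thm. 5.1.3 and Cor. 5.1.4]
[cite: SteinWuthrich2013, Thm. 6.1 (p. 20)] [cite: Miller2011LMS, Def. 1.1 and §1] -/
theorem bsdp_of_invariantsMatchAt
    (hKato : kato_charIdeal_dvd_multiplicative_of_surjective)
    (hJs : SteinWuthrich2013.thm61_splitMultiplicative)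
    (hJn : SteinWuthrich2013.thm61_nonsplitMultiplicative)
    (hHs : SteinWuthrich2013.exists_isSplitMultCanonical)
    (hHn : SteinWuthrich2013.exists_isMultCanonical)
    (hGZK : rank_eq_analyticRank_of_analyticRank_le_one) (hmod : hasEntireLFunction_rat)
    (hpar : nonempty_modularParametrizationData)
    (W : WeierstrassCurve ℚ) [W.IsElliptic] [W.IsGloballyMinimal] (p : ℕ) [Fact p.Prime]
    (hGS : greenberg_stevens (W := W) (p := p))
    (hp : 5 ≤ p) (hmult : W.HasMultiplicativeReductionAtPrime p)
    (hsurj : W.HasSurjectiveModNGaloisRep p) (hr : W.analyticRank = 0)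
    (hinv : InvariantsMatchAt W p) : BSDp W p :=
  X2.bsdp_of_mazurMainConjectureAt_of_analyticRank_eq_zero hJs hJn hHs hHn hGZK hmod hpar W p hGS
    (by omega) hmult hr (mazurMainConjectureAt_of_invariantsMatchAt hKato hmod W p hGS hp hmult hsurj hr hinv)

end Summit.BirchSwinnertonDyer.Rank1Residual.X11a

end
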